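import Mathlib
import Summits.RiemannHypothesis.RiemannHypothesis.Theorems.HandoffXiZeroCount
import Summits.RiemannHypothesis.RiemannHypothesis.Theorems.HandoffCountThinLower
import Literature.NumberTheory.LFunctions.RiemannXiProofs
import Literature.NumberTheory.LFunctions.ZetaZeros
import HarnessLib

/-!
# ROUTE R-K «COUNT-AND-THIN» IN CANONICAL FORM, II: the parameter-free pair implies RH

Handoff track (ROUTE 1′), prove-1 gen13; Part I is `HandoffCountThinCanonical` (the normalisers of
SC-3 are superfluous since `Ξ(0) ≠ 0`); this part imports the one-sided count
(`HandoffCountThinLower`) and records the CANONICAL PAIR: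

* `riemannHypothesis_of_frequently_countGe_of_selfNormalised` — `F_t` entire and real on `ℝ`; for
  every `T > 0` an open `U ⊇ [0, T]` with `F_t(z)/F_t(0) → Ξ(z)/Ξ(0)` locally uniformly on `U`; for
  unboundedly many `T`, eventually `#{x ∈ (0,T] : F_t(x) = 0} ≥ N(T)` ⟹ `RiemannHypothesis`;
* `riemannHypothesis_of_frequently_countGe_of_selfNormalised_thin` — the same from uniform
  convergence of `F_t(z)/F_t(0)` on idea-3's thin rectangles `[0, T] × [-δ, δ]` (even families);
* `natCast_le_encard_zeros_of_near_alternating` — the finite-`t` certificate form of the lower count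
  (sup-norm distance `η` on `[0, T]` + `N + 1` alternating values of modulus `≥ η` ⟹ `≥ N` zeros).

(The two short analysis steps of Part I are repeated inside the proofs as `have`s, so that this file
depends on one Handoff olean only.) A pure implication between statements about an unspecified
family and RH; nothing here is, or suggests, a proof of RH.
-/

set_option linter.dupNamespace false  -- the mandated namespace repeats `RiemannHypothesis`

noncomputable section

open Filter Set Topology Metric Complex
open Literature.NumberTheory.LFunctions

namespace Summit.RiemannHypothesis.RiemannHypothesis.Theorems

namespace CountThin

/-- **ROUTE R-K, canonical form.** `F_t` entire and real on `ℝ`; for every `T > 0` an open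
`U ⊇ [0, T]` on which `F_t(z)/F_t(0) → Ξ(z)/Ξ(0)` locally uniformly (no normalisers); and for
unboundedly many `T`, eventually `#{x ∈ (0, T] : F_t(x) = 0} ≥ N(T)` (lower count). Then the
Riemann Hypothesis holds. (The convergence at `z = 0` forces `F_t(0) ≠ 0` for large `t`; the real
normalisers `Ξ(0)/F_t(0)` then reduce to `riemannHypothesis_of_frequently_countGe_of_nhds`.) -/
theorem riemannHypothesis_of_frequently_countGe_of_selfNormalised {F : ℝ → ℂ → ℂ}
    (hdiff : ∀ t, Differentiable ℂ (F t)) (hreal : ∀ (t : ℝ) (x : ℝ), (F t x).im = 0)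
    (hC : ∃ᶠ T : ℝ in atTop, ∀ᶠ t : ℝ in atTop,
      (zetaZeroCount T : ℕ∞) ≤ {x : ℝ | 0 < x ∧ x ≤ T ∧ F t x = 0}.encard)
    (hconv : ∀ T : ℝ, 0 < T → ∃ U : Set ℂ, IsOpen U ∧ (∀ x ∈ Icc (0 : ℝ) T, (x : ℂ) ∈ U) ∧
      TendstoLocallyUniformlyOn (fun t z => F t z / F t 0)
        (fun z => riemannXiUpper z / riemannXiUpper 0) atTop U) :
    RiemannHypothesis := by
  classical
  -- `Ξ(0) ≠ 0` and `Ξ(0)` is real (Part I: `riemannXiUpper_zero_ne_zero`, `ofReal_re_riemannXiUpper_zero`)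
  have hΞ0 : riemannXiUpper 0 ≠ 0 := fun h => re_ne_zero_of_riemannXiUpper_eq_zero h (by simp)
  have hΞ0real : (((riemannXiUpper 0).re : ℝ) : ℂ) = riemannXiUpper 0 :=
    Complex.ext (by simp) (by simpa using (im_riemannXiUpper_ofReal_holds 0).symm)
  have hΞ0re : (riemannXiUpper 0).re ≠ 0 := fun h => hΞ0 (by rw [← hΞ0real, h]; simp)
  -- real normalisers, nonzero for every `t`
  set c : ℝ → ℝ := fun t => if (F t 0).re = 0 then 1 else (riemannXiUpper 0).re / (F t 0).re
    with hc_def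
  have hc : ∀ t, c t ≠ 0 := by
    intro t
    by_cases h : (F t 0).re = 0
    · simp [c, h]
    · simp [c, h, hΞ0re]
  refine riemannHypothesis_of_frequently_countGe_of_nhds hdiff hreal hc hC fun T hT0 => ?_
  obtain ⟨U, hUo, hseg, hloc⟩ := hconv T hT0
  refine ⟨U, hUo, hseg, ?_⟩
  have h0U : (0 : ℂ) ∈ U := by simpa using hseg 0 ⟨le_rfl, hT0.le⟩
  -- eventually `F t 0 ≠ 0`
  have hev : ∀ᶠ t : ℝ in atTop, F t 0 ≠ 0 := by
    have h1 : Tendsto (fun t => F t 0 / F t 0) atTop (𝓝 (riemannXiUpper 0 / riemannXiUpper 0)) :=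
      hloc.tendsto_at h0U
    rw [div_self hΞ0] at h1
    filter_upwards [h1.eventually (isOpen_ne.mem_nhds one_ne_zero)] with t ht h
    exact ht (by simp [h])
  -- Part I, `tendstoLocallyUniformlyOn_of_selfNormalised`, inlined: `(Ξ(0)/F_t(0)) · F_t → Ξ`
  have key : TendstoLocallyUniformlyOn (fun t z => riemannXiUpper 0 / F t 0 * F t z) riemannXiUpper
      atTop U := by
    have hg : UniformContinuous fun w : ℂ => riemannXiUpper 0 * w := uniformContinuous_id.const_mul' _
    refine ((hg.comp_tendstoLocallyUniformlyOn hloc).congr fun t z _ => ?_).congr_right fun z _ => ?_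
    · show riemannXiUpper 0 * (F t z / F t 0) = riemannXiUpper 0 / F t 0 * F t z
      ring
    · show riemannXiUpper 0 * (riemannXiUpper z / riemannXiUpper 0) = riemannXiUpper z
      field_simp [hΞ0]
  refine key.congr_inseparable (hev.mono fun t ht z _ => Inseparable.of_eq ?_)
  have hre : (((F t 0).re : ℝ) : ℂ) = F t 0 :=
    Complex.ext (by simp) (by simpa using (hreal t 0).symm)
  have hre0 : (F t 0).re ≠ 0 := fun h => ht (by rw [← hre, h]; simp)
  have hct : c t = (riemannXiUpper 0).re / (F t 0).re := by simp [c, hre0]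
  show riemannXiUpper 0 / F t 0 * F t z = ((c t : ℝ) : ℂ) * F t z
  rw [hct, Complex.ofReal_div, hΞ0real, hre]

/-- **ROUTE R-K, canonical form on idea-3's thin rectangles (even families).** `F_t` entire, real
on `ℝ`, even; for one `δ > 0` and every `T > 0`, `F_t(z)/F_t(0) → Ξ(z)/Ξ(0)` uniformly on
`[0, T] × [-δ, δ]`; and for unboundedly many `T`, eventually `#{x ∈ (0, T] : F_t(x) = 0} ≥ N(T)`.
Then the Riemann Hypothesis holds. -/
theorem riemannHypothesis_of_frequently_countGe_of_selfNormalised_thin {F : ℝ → ℂ → ℂ}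
    (hdiff : ∀ t, Differentiable ℂ (F t)) (hreal : ∀ (t : ℝ) (x : ℝ), (F t x).im = 0)
    (heven : ∀ (t : ℝ) (z : ℂ), F t (-z) = F t z)
    (hC : ∃ᶠ T : ℝ in atTop, ∀ᶠ t : ℝ in atTop,
      (zetaZeroCount T : ℕ∞) ≤ {x : ℝ | 0 < x ∧ x ≤ T ∧ F t x = 0}.encard)
    (hT : ∃ δ : ℝ, 0 < δ ∧ ∀ T : ℝ, 0 < T →
      TendstoUniformlyOn (fun t z => F t z / F t 0)
        (fun z => riemannXiUpper z / riemannXiUpper 0) atTop (Icc 0 T ×ℂ Icc (-δ) δ)) :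
    RiemannHypothesis := by
  obtain ⟨δ, hδ, hconv⟩ := hT
  refine riemannHypothesis_of_frequently_countGe_of_selfNormalised hdiff hreal hC fun T hT0 => ?_
  set Φ : ℝ → ℂ → ℂ := fun t z => F t z / F t 0 with hΦ
  set Ψ : ℂ → ℂ := fun z => riemannXiUpper z / riemannXiUpper 0 with hΨ
  set R : Set ℂ := Icc 0 (T + 1) ×ℂ Icc (-δ) δ with hR
  have h : TendstoUniformlyOn Φ Ψ atTop R := hconv (T + 1) (by linarith)
  refine ⟨Ioo (-(T + 1)) (T + 1) ×ℂ Ioo (-δ) δ, isOpen_Ioo.reProdIm isOpen_Ioo, fun x hx =>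
    mem_reProdIm.mpr ⟨⟨by simp; linarith [hx.1], by simp; linarith [hx.2]⟩, by simp [hδ], by simp [hδ]⟩,
    ?_⟩
  have h' : TendstoUniformlyOn Φ Ψ atTop ((fun z : ℂ => -z) ⁻¹' R) := by
    have := h.comp (fun z : ℂ => -z)
    have hΦ' : (fun t => Φ t ∘ fun z : ℂ => -z) = Φ := by funext t z; simp [Φ, heven]
    have hΨ' : (Ψ ∘ fun z : ℂ => -z) = Ψ := by funext z; simp [Ψ, riemannXiUpper_neg]
    rwa [hΦ', hΨ'] at this
  have hU : TendstoUniformlyOn Φ Ψ atTop (R ∪ (fun z : ℂ => -z) ⁻¹' R) := by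
    intro u hu
    filter_upwards [h u hu, h' u hu] with n hn hn' x hx
    exact hx.elim (hn x) (hn' x)
  refine (hU.mono ?_).tendstoLocallyUniformlyOn
  intro z hz
  obtain ⟨⟨hr1, hr2⟩, hi1, hi2⟩ := mem_reProdIm.mp hz
  rcases le_or_gt 0 z.re with hre | hre
  · exact Or.inl (mem_reProdIm.mpr ⟨⟨hre, hr2.le⟩, hi1.le, hi2.le⟩)
  · exact Or.inr (mem_reProdIm.mpr
      ⟨⟨by simp; exact hre.le, by simp; linarith⟩, by simp; linarith, by simp; linarith⟩)

/-! ## The finite-`t` certificate form of the lower count -/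

/-- **Certified sign changes transfer.** If `|g x − f x| < η` on `[0, T]` and `f` alternates in sign
at nodes `0 < x₀ < ⋯ < x_N ≤ T` with `|f(x_i)| ≥ η`, then `g` alternates at the same nodes, hence
(`natCast_le_encard_zeros_of_sign_changes`) has `≥ N` zeros in `(0, T]`. This is what a census at a
fixed `t` certifies for `g = Re(c_t û_t)`, `f = Ξ|_ℝ`: a sup-norm distance `η` on `[0, T]` and
`N(T) + 1` certified values of `Ξ` of alternating sign and modulus `≥ η`. -/
theorem natCast_le_encard_zeros_of_near_alternating {f g : ℝ → ℝ} (hg : Continuous g) {N : ℕ}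
    {T η : ℝ} (hclose : ∀ x ∈ Icc (0 : ℝ) T, |g x - f x| < η)
    (x : Fin (N + 1) → ℝ) (hx : StrictMono x) (hx0 : 0 < x 0) (hxT : x (Fin.last N) ≤ T)
    (hbig : ∀ i, η ≤ |f (x i)|) (hsign : ∀ i : Fin N, f (x i.castSucc) * f (x i.succ) < 0) :
    (N : ℕ∞) ≤ {y : ℝ | 0 < y ∧ y ≤ T ∧ g y = 0}.encard := by
  -- at every node `g` has the sign of `f`
  have hmem : ∀ i, x i ∈ Icc (0 : ℝ) T := fun i =>
    ⟨(hx0.trans_le (hx.monotone (Fin.zero_le _))).le, (hx.monotone (Fin.le_last _)).trans hxT⟩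
  have hsame : ∀ i, 0 < f (x i) * g (x i) := by
    intro i
    have hc := hclose (x i) (hmem i)
    have hb := hbig i
    rcases le_or_gt 0 (f (x i)) with hf | hf
    · have hf' : η ≤ f (x i) := by rwa [abs_of_nonneg hf] at hb
      have : 0 < g (x i) := by linarith [(abs_lt.mp hc).1]
      exact mul_pos (lt_of_lt_of_le (by linarith [(abs_lt.mp hc).1, (abs_lt.mp hc).2]) hf') this
    · have hf' : η ≤ -f (x i) := by rwa [abs_of_neg hf] at hb
      have : g (x i) < 0 := by linarith [(abs_lt.mp hc).2]
      exact mul_pos_of_neg_of_neg hf this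
  refine natCast_le_encard_zeros_of_sign_changes hg x hx hx0 hxT fun i => ?_
  -- sign of g(x_i) g(x_{i+1}) = sign of f(x_i) f(x_{i+1}) < 0
  have h1 := hsame i.castSucc
  have h2 := hsame i.succ
  have hs := hsign i
  nlinarith [mul_pos h1 h2, hs]

/-! Axiom census (expected `propext`, `Classical.choice`, `Quot.sound`). -/
#print axioms riemannHypothesis_of_frequently_countGe_of_selfNormalised_thin

end CountThin

end Summit.RiemannHypothesis.RiemannHypothesis.Theorems

end
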